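import Summits.BirchSwinnertonDyer.Rank1Residual.X11b.BDPRouteTwistCertificateShaAn
import Summits.BirchSwinnertonDyer.Rank1Residual.X11b.BDPRouteSurj
import HarnessLib

/-!
# Class X11b, route p2: the twist certificate is demanded EXACTLY where it can exist — a Heegner
# twist value has `p`-adic valuation at least `ord_p ∏_ℓ c_ℓ(E)` (cell `b2b-bsdres`, sub-cell
# `multr1-p2`, gen 23)

HONEST FRAMING (cell `b2b-bsdres`, run/shared/lean/b2b/bsd-rank1-residual/, verbatim in every
file): the goal of the cell is to DELETE the COMBINATION-SHAPED residual classes of the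
Birch–Swinnerton-Dyer formula for ALL analytic-rank `≤ 1` elliptic curves over `ℚ` — "full BSD
formula for every rank `≤ 1` curve in class `C`" assembled STRICTLY from published theorems — so
that the rank-`≤ 1` remainder becomes exactly the CONSTRUCTION-SHAPED classes, which are TYPED
(missing-input `Prop`s), NOT attempted. This is not "finishing BSD". Sub-cell `multr1-p2` is a
RESEARCH ROUTE on class X11b (`ClassX11b W p := r_an = 1 ∧ p ≠ 2 ∧ mult(p) ∧ irr(p)`,
`Partition/Rows.lean`); no claim beyond the stated class and loci; X11b's label does not change;
NOTHING is booked by this file.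

THEOREMS ONLY (no definition, no named fact, no `sorry`). A NECESSITY statement for the route's
bookkeeping: the gen-22 records (`P2.bsdp_of_onTree_cyclotomic_twistCertificate`, gen 23's
`P2.bsdp_of_onTree_print / _halves / _frame`, `P2.bsdp_of_semistable_of_imcDiv`) demand the twist
certificate (TC) — a Heegner field `K`, a globally minimal model `Wd` of `E^{d_K}` and its algebraic
central value `q_d = L(E^{d_K},1)/Ω(Wd)` with `ord_p q_d = 0` — ONLY on pairs with `p ∤ ∏_ℓ c_ℓ(E)`.
REPORT §28.1 argued informally that this restriction loses nothing. Here it is a kernel theorem from a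
PUBLISHED fact: by Wuthrich 2014 Prop. 21 (Kato's Euler system; tree fact `sha_dvd_analyticSha`)
applied to the rank-`0` twist `Wd` — multiplicative at `p` and with `ρ̄` onto by transport from `E`
along a Heegner field (`hasMultiplicativeReductionAtPrime_twist_of_heegner`, `surj_twist_model`) —
`ord_p #Ш(Wd) + ord_p ∏c(Wd) − 2·ord_p #Wd(ℚ)_tors ≤ ord_p q_d` (`twist_le_half_of_wuthrich`, gen 4);
irreducibility kills the torsion term and the Tamagawa transport at a Heegner field gives
`ord_p ∏c(Wd) = ord_p ∏c(E)` (`padicValNat_tamagawaProduct_twist_of_heegner`, `p ≥ 5`). Hence: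

* `padicValNat_tamagawaProduct_le_padicValRat_twistValue` — at a multiplicative `p ≥ 5` with `ρ̄_{E,p}`
  onto, for EVERY imaginary quadratic Heegner field `K` of `E` and every globally minimal model `Wd`
  of `E^{d_K}` with `L(Wd,1) ≠ 0`: `ord_p ∏_ℓ c_ℓ(E) ≤ ord_p (L(Wd,1)/Ω(Wd))` (indeed
  `ord_p #Ш(Wd) + ord_p ∏c(E) ≤ ord_p q_d`).
* **`not_dvd_tamagawaProduct_of_twistUnit`** — a twist certificate (`ord_p q_d = 0`) forces
  `p ∤ ∏_ℓ c_ℓ(E)`: on the 2 092 ‖ 167 ¬(ram) ∧ surj pairs and the 61 998 ‖ 2 149 (ram) pairs with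
  `p ∣ ∏c` (census gen 21/22) NO twist certificate exists, so the records' restriction of (TC) to
  `p ∤ ∏c` is forced, not a choice; there the roads are REG (Kato + Disegni), the Shimura displays,
  or the conjecture on the 334 peu-ramifié split-only pairs.

No analytic rank hypothesis on `E` is needed. Nothing booked; labels UNCHANGED.

References: [Wuthrich2014] Prop. 21 (p. 400); [McCallumLMS1991] §1; [JetchevSkinnerWan2017] §7.4.1
(p. 30); [SilvermanAEC2009] VII.5; [Miller2011LMS] Def. 1.1.
-/

noncomputable section

open scoped Classical NumberField

open WeierstrassCurve NumberField IsDedekindDomain Field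
open Literature.NumberTheory.EllipticCurves Literature.NumberTheory.EllipticCurves.GreenbergSelmer
open Literature.NumberTheory.EllipticCurves.ModularForms
open Literature.NumberTheory.EllipticCurves.Rank1Residual
open Literature.NumberTheory.EllipticCurves.Rank1Residual.Typed
open Literature.NumberTheory.EllipticCurves.Wuthrich2014
open Literature.NumberTheory.QuadraticFields.Quadratic
open Literature.NumberTheory.GaloisRepresentations Literature.NumberTheory.GaloisCohomology

namespace Summit.BirchSwinnertonDyer.Rank1Residual.X11b

section Necessity

variable (W : WeierstrassCurve ℚ) [W.IsElliptic] (p : ℕ) [Fact p.Prime]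

/-- **A Heegner twist value carries at least the `p`-part of `∏_ℓ c_ℓ(E)`.** For `E/ℚ` (minimal model
`W`) multiplicative at `p ≥ 5` with `ρ̄_{E,p}` onto (so irreducible), an imaginary quadratic `K` satisfying the
Heegner hypothesis for `N_E`, a globally minimal model `Wd` of `E^{d_K}` with `L(Wd,1) ≠ 0`, and its
algebraic central value `q_d = L(Wd,1)/Ω(Wd)`: `ord_p #Ш(Wd) + ord_p ∏_ℓ c_ℓ(E) ≤ ord_p q_d`. Proof:
Wuthrich 2014 Prop. 21 for `Wd` (`twist_le_half_of_wuthrich`: multiplicative at `p` and onto image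
transported from `E`), `p ∤ #Wd(ℚ)_tors` (irreducible, transported), and
`ord_p ∏c(Wd) = ord_p ∏c(E)` (Tamagawa transport at a Heegner field, `p ≥ 5`).
[cite: Wuthrich2014, Prop. 21 (p. 400)] [cite: JetchevSkinnerWan2017, §7.4.1 (p. 30), Tamagawa numbers of the twist] -/
theorem padicValNat_tamagawaProduct_le_padicValRat_twistValue (hWu : sha_dvd_analyticSha)
    (hGZK : rank_eq_analyticRank_of_analyticRank_le_one) (hnf : exists_isNewformOf)
    (hp5 : 5 ≤ p) (hmult : Mult W p) (hirr : Irr W p) (hsurj : Surj W p)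
    (K : Type) [Field K] [NumberField K] (hK : IsImaginaryQuadratic K)
    (hHN : SatisfiesHeegnerHypothesis (W.conductorNorm ℤ) K)
    (Wd : WeierstrassCurve ℚ) [Wd.IsElliptic] [Wd.IsGloballyMinimal] (Cd : VariableChange ℚ)
    (hWd : Cd • W.quadraticTwist (NumberField.discr K : ℚ) = Wd)
    (qd : ℚ) (hqd : Wd.entireLFunction 1 / (Wd.realPeriodRat : ℂ) = (qd : ℂ)) (hqd0 : qd ≠ 0) :
    (padicValNat p Wd.shaOrder : ℤ) + padicValNat p W.tamagawaProduct ≤ padicValRat p qd := by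
  have hmod : hasEntireLFunction_rat := hasEntireLFunction_rat_of_exists_isNewformOf hnf
  have hp2 : p ≠ 2 := by omega
  -- `L(Wd,1) ≠ 0`
  have hL1 : Wd.entireLFunction 1 ≠ 0 := by
    intro h0
    apply hqd0
    have : ((qd : ℂ)) = 0 := by rw [← hqd, h0, zero_div]
    exact_mod_cast this
  -- transport of the reduction type, the image and irreducibility to the twist
  have hmultd : Wd.HasMultiplicativeReductionAtPrime p :=
    hasMultiplicativeReductionAtPrime_twist_of_heegner W p K hK hHN hp2 hmult Cd hWd
  have hsurjd : Surj Wd p := surj_twist_model W p K hsurj Cd hWd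
  have hirrd : Wd.HasIrreducibleModPGaloisRep p :=
    hasIrreducibleModPGaloisRep_twist_model W p K hK.1 hirr Cd hWd
  -- Wuthrich 2014 Prop. 21 for the rank-zero twist
  obtain ⟨q, hq, hle⟩ := twist_le_half_of_wuthrich hWu hGZK hmod Wd p hp2 hL1 hmultd hsurjd
  have hqq : q = qd := by exact_mod_cast hq.symm.trans hqd
  subst hqq
  have htors : padicValNat p Wd.torsionOrder = 0 :=
    padicValNat_torsionOrder_eq_zero_of_irreducible Wd p hirrd
  have htam : padicValNat p Wd.tamagawaProduct = padicValNat p W.tamagawaProduct :=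
    padicValNat_tamagawaProduct_twist_of_heegner W p hp5 K hK hHN Cd hWd
  rw [htors, htam] at hle
  omega

/-- **No twist certificate when `p ∣ ∏_ℓ c_ℓ(E)`.** Under the hypotheses of
`padicValNat_tamagawaProduct_le_padicValRat_twistValue`, a unit twist value (`ord_p q_d = 0`) forces
`p ∤ ∏_ℓ c_ℓ(E)` (and `Ш(Wd)[p] = 0`). So the records' demand of the twist certificate ONLY on pairs
with `p ∤ ∏c` (gen 22 `P2.bsdp_of_onTree_cyclotomic_twistCertificate`; gen 23 `P2.bsdp_of_onTree_print
/ _halves / _frame`, `P2.bsdp_of_semistable_of_imcDiv`) is forced by Kato's Euler system, not a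
choice: on the 2 092 ‖ 167 ¬(ram) ∧ surj and the 61 998 ‖ 2 149 (ram) X11b-shape pairs with
`p ∣ ∏c` (`N < 5·10⁵ ‖ N < 2·10⁴`) no Heegner twist value is a `p`-adic unit.
[cite: Wuthrich2014, Prop. 21 (p. 400)] [cite: JetchevSkinnerWan2017, §7.4.1 (p. 30)] -/
theorem not_dvd_tamagawaProduct_of_twistUnit (hWu : sha_dvd_analyticSha)
    (hGZK : rank_eq_analyticRank_of_analyticRank_le_one) (hnf : exists_isNewformOf)
    (hp5 : 5 ≤ p) (hmult : Mult W p) (hirr : Irr W p) (hsurj : Surj W p)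
    (K : Type) [Field K] [NumberField K] (hK : IsImaginaryQuadratic K)
    (hHN : SatisfiesHeegnerHypothesis (W.conductorNorm ℤ) K)
    (Wd : WeierstrassCurve ℚ) [Wd.IsElliptic] [Wd.IsGloballyMinimal] (Cd : VariableChange ℚ)
    (hWd : Cd • W.quadraticTwist (NumberField.discr K : ℚ) = Wd)
    (qd : ℚ) (hqd : Wd.entireLFunction 1 / (Wd.realPeriodRat : ℂ) = (qd : ℂ)) (hqd0 : qd ≠ 0)
    (hvd : padicValRat p qd = 0) :
    ¬ p ∣ W.tamagawaProduct ∧ padicValNat p Wd.shaOrder = 0 := by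
  have hle := padicValNat_tamagawaProduct_le_padicValRat_twistValue W p hWu hGZK hnf hp5 hmult hirr
    hsurj K hK hHN Wd Cd hWd qd hqd hqd0
  rw [hvd] at hle
  have hsha : padicValNat p Wd.shaOrder = 0 := by omega
  have htam : padicValNat p W.tamagawaProduct = 0 := by omega
  refine ⟨fun hdvd ↦ ?_, hsha⟩
  have hpos : 0 < W.tamagawaProduct := W.tamagawaProduct_pos'
  have h1 : 1 ≤ padicValNat p W.tamagawaProduct :=
    one_le_padicValNat_of_dvd hpos.ne' hdvd
  omega

/-- **On X11b at `p ≥ 5` with surjective image: the twist certificate exists ONLY IF `p ∤ ∏c`** —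
the class-level reading of `not_dvd_tamagawaProduct_of_twistUnit` in the shape of the records'
(TC) binder. [cite: Wuthrich2014, Prop. 21 (p. 400)] -/
theorem not_dvd_tamagawaProduct_of_classX11b_of_exists_twistUnit (hWu : sha_dvd_analyticSha)
    (hGZK : rank_eq_analyticRank_of_analyticRank_le_one) (hnf : exists_isNewformOf)
    (hX : ClassX11b W p) (hp5 : 5 ≤ p) (hsurj : Surj W p)
    (hTC : ∃ (K : Type) (_ : Field K) (_ : NumberField K) (Wd : WeierstrassCurve ℚ)
      (_ : Wd.IsElliptic) (_ : Wd.IsGloballyMinimal) (Cd : VariableChange ℚ) (qd : ℚ),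
      IsImaginaryQuadratic K ∧ SatisfiesHeegnerHypothesis (W.conductorNorm ℤ) K ∧
      NumberField.discr K < -4 ∧ Cd • W.quadraticTwist (NumberField.discr K : ℚ) = Wd ∧
      Wd.entireLFunction 1 / (Wd.realPeriodRat : ℂ) = (qd : ℂ) ∧ qd ≠ 0 ∧ padicValRat p qd = 0) :
    ¬ p ∣ W.tamagawaProduct := by
  obtain ⟨K, _, _, Wd, _, _, Cd, qd, hK, hHN, -, hWd, hqd, hqd0, hvd⟩ := hTC
  exact (not_dvd_tamagawaProduct_of_twistUnit W p hWu hGZK hnf hp5 hX.2.2.1 hX.2.2.2 hsurj K hK hHN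
    Wd Cd hWd qd hqd hqd0 hvd).1

end Necessity

end Summit.BirchSwinnertonDyer.Rank1Residual.X11b

end
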